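import Summits.BirchSwinnertonDyer.BirchSwinnertonDyer.Theorems.RamifiedHeegnerPairLeafPartnerGenusReduction
import Literature.NumberTheory.EllipticCurves.KolyvaginShaStructureIndexFormProofs
import HarnessLib

/-!
# Crux U₁ `LeafRankOneUpperAtThree` (stmt-BirchSwinnertonDyer-26022) ∕ U₀ (26024), line `partnerdescent` — partner kernel part 21:
# label (B5) of the descended family — the CONGRUENCE `red(γ·ys(m)) = Frob_ℓ · red(γ·ys(m/ℓ)↑)` above an inert `ℓ`

HONEST FRAMING (lead prover `bsd-line-rhp-p2` g58, explicit-unit seat, cell `bsd-wall`): a SUPPORT file (`--supports 26022 --as helper`)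
for the registered stub (DISPLAY-L) `stub_partnerGenusDisplayLabelledAtThree`. It proves NO stub and closes NO item; BSD is proved for no
curve. Theorems only; no definition, no named fact, no `sorry`.

WHAT. The (B5) conjunct of `ShimuraWalk.LabelsAt` (Gross Prop. 3.7 (2)) for the re-signed descended family `ys(m) = c_m • D_m`,
`D_m↑K[3m] = ψ_θ((1 − σ_m) y(3m))`, from the fact's (B5′) for the `V`-points at conductors `3m`, `3(m/ℓ)`, in the tree's currency
(`geomReduction` along `placeOver ℓ`, `RatClosure.pointsEquiv`, a coordinatewise `j = (·).map emb`):
* §1 `exists_ringHom_extension` — an embedding `K[m] → K̄` extends to `K[3m] → K̄` (`IsAlgClosed.lift`; `K[3m]` is a number field).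
* §2 `pointsEquiv_symm_map_descent_eq` — READING THE DESCENT OVER `ℚ̄`: for `γ̃ ∈ Gal(K[3m]/K)` fixing `θ` and restricting to `γ`,
  `emb₃` extending `emb`, and `D↑ = ψ_θ z`: `θ_ℚ̄⁻¹(emb_*(γ D)) = ψ_Θ(θ_ℚ̄⁻¹(emb₃_*(γ̃ z)))`, `Θ = θ_ℚ̄⁻¹(emb₃ θ)` (parts 16 ∕ 10:
  `map_inclusion_pointGalHom_res_eq`, `genusTransport_map_of_eq` twice, `Affine.Point.map_map`).
* §3 `labelB5_of_descents` — (B5′) at `γ̃` and at `γ̃σ_m` (additivity), `σ_m(y′↑) = (σ′y′)↑`, `ψ_θ ∘ ↑ = ↑ ∘ ψ_{θ′}` (part 19), the two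
  inclusions `K[m/ℓ] → K[3m]` agree, §2 twice, and the (B5) CORE of part 20 (`red_W ψ_Θ Q = χ₋₃(ℓ) φ₀ red_W ψ_Θ Q₀`): with
  `c_m = χ₋₃(ℓ) c_{m/ℓ}` the sign cancels — VERBATIM the (B5) clause for `ys(m) = c_m • D_m`, `ys(m/ℓ) = c_{m/ℓ} • D_{m/ℓ}`, at every
  inert good `ℓ ≠ 3`, `ℓ = 2` included.
Typed ≠ proved for the stub; BSD is proved for no curve.
[cite: GrossLMS1991, §3 Prop. 3.7 (2) (p. 237)] [cite: Nekovar2007, (4.9) (p. 571), (4.13) (ii)] [cite: SilvermanAEC2009, VII.2 Prop. 2.1, X.5 Cor. 5.4 (iii)]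
presearch: as parts 14–20; nothing restated.
-/

noncomputable section

set_option linter.dupNamespace false
set_option autoImplicit false

open scoped Classical NumberField Pointwise

namespace Summit.BirchSwinnertonDyer.BirchSwinnertonDyer.Theorems.LeafPartnerGenusLabelB5

open WeierstrassCurve Literature.NumberTheory.EllipticCurves Literature.NumberTheory.GaloisRepresentations
  Summit.BirchSwinnertonDyer.BirchSwinnertonDyer.Theorems.LeafPartnerGenusTransport
  Summit.BirchSwinnertonDyer.BirchSwinnertonDyer.Theorems.LeafPartnerGenusLift
  Summit.BirchSwinnertonDyer.BirchSwinnertonDyer.Theorems.LeafPartnerGenusLabelB4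
  Summit.BirchSwinnertonDyer.BirchSwinnertonDyer.Theorems.LeafPartnerGenusReduction
  IsDedekindDomain Field NumberField

variable {K : Type} [Field K] [NumberField K]

/-! ## §1 Extending an embedding `K[m] → K̄` to `K[n] → K̄` -/

/-- **An embedding `K[m] → K̄` extends along `K[m] ⊆ K[n]` to `K[n] → K̄`** (`K[n]` is a number field, hence algebraic over `K[m]`;
`K̄` is algebraically closed: `IsAlgClosed.lift`). [folklore] [cite: GrossLMS1991, §3 (the tower K ⊂ K_m ⊂ K_n)] -/
theorem exists_ringHom_extension (hK : IsImaginaryQuadratic K) (ι : K →+* ℂ) {m n : ℕ} (hn : n ≠ 0)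
    (hle : ringClassField K ι m ≤ ringClassField K ι n) (emb : ringClassField K ι m →+* AlgebraicClosure K) :
    ∃ emb' : ringClassField K ι n →+* AlgebraicClosure K, ∀ x, emb' (RingClassField.inclusion ι hle x) = emb x := by
  haveI : NumberField (ringClassField K ι n) := numberField_ringClassField hK ι hn
  letI algS : Algebra (ringClassField K ι m) (ringClassField K ι n) := (RingClassField.inclusion ι hle).toRingHom.toAlgebra
  letI algM : Algebra (ringClassField K ι m) (AlgebraicClosure K) := emb.toAlgebra
  haveI : IsScalarTower ℚ (ringClassField K ι m) (ringClassField K ι n) :=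
    IsScalarTower.of_algebraMap_eq fun q => by
      show algebraMap ℚ (ringClassField K ι n) q = RingClassField.inclusion ι hle (algebraMap ℚ (ringClassField K ι m) q)
      rw [eq_ratCast, eq_ratCast, map_ratCast]
  haveI : Algebra.IsAlgebraic (ringClassField K ι m) (ringClassField K ι n) :=
    Algebra.IsAlgebraic.tower_top (K := ℚ) (ringClassField K ι m)
  refine ⟨(IsAlgClosed.lift (R := ringClassField K ι m) (S := ringClassField K ι n) (M := AlgebraicClosure K)).toRingHom,
    fun x => ?_⟩
  exact (IsAlgClosed.lift (R := ringClassField K ι m) (S := ringClassField K ι n) (M := AlgebraicClosure K)).commutes x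

/-! ## §2 Reading the descent over `ℚ̄` -/

section Read

variable (W : WeierstrassCurve ℚ) {W₁ : WeierstrassCurve ℚ} [W₁.IsCharNeTwoNF] (C₁ : VariableChange ℚ) (hC₁ : C₁ • W = W₁)
  {V : WeierstrassCurve ℚ} (CV : VariableChange ℚ) (hV : CV • W₁.quadraticTwist (-3) = V)

/-- `θ_ℚ̄⁻¹ = ((Literature.NumberTheory.EllipticCurves.absClosureEquiv ℚ K)⁻¹)_*` on points (unfolding `RatClosure.pointsEquiv`). [folklore] -/
theorem pointsEquiv_symm_apply (X : WeierstrassCurve ℚ) (P : geomPoints (X.baseChange K)) :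
    (RatClosure.pointsEquiv (K := K) X).symm P =
      Affine.Point.map (W' := X) (Literature.NumberTheory.EllipticCurves.absClosureEquiv ℚ K).symm.toAlgHom P := rfl

/-- **Reading the descent over `ℚ̄`.** `γ̃ ∈ Gal(K[3m]/K)` fixing `θ` with restriction `res γ̃` to `K[m]`, `emb₃ : K[3m] → K̄` extending
`emb : K[m] → K̄`, `D ∈ W(K[m])` with `D↑ = ψ_θ z`, `Θ = θ_ℚ̄⁻¹(emb₃ θ)`: `θ_ℚ̄⁻¹(emb_*((res γ̃) D)) = ψ_Θ(θ_ℚ̄⁻¹(emb₃_*(γ̃ z)))` in `W(ℚ̄)`.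
[cite: SilvermanAEC2009, X.5 Cor. 5.4 (iii)] [cite: GrossLMS1991, §3] -/
theorem pointsEquiv_symm_map_descent_eq (hK : IsImaginaryQuadratic K) (ι : K →+* ℂ) {m : ℕ} (hm : m ≠ 0)
    (hle : ringClassField K ι m ≤ ringClassField K ι (3 * m))
    {res : ringClassGal ι (3 * m) →* (ringClassField K ι m ≃ₐ[ℚ] ringClassField K ι m)}
    (hres : ∀ (g : ringClassGal ι (3 * m)) (x : ringClassField K ι m) (y : ringClassField K ι (3 * m)),
      (x : ℂ) = (y : ℂ) → ((res g x : ringClassField K ι m) : ℂ) =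
        (((g : ringClassField K ι (3 * m) ≃ₐ[ℚ] ringClassField K ι (3 * m)) y : ringClassField K ι (3 * m)) : ℂ))
    {θ : ringClassField K ι (3 * m)} (hθ2 : θ ^ 2 = algebraMap ℚ (ringClassField K ι (3 * m)) (-3))
    (gt : ringClassGal ι (3 * m)) (hgt : (gt : ringClassField K ι (3 * m) ≃ₐ[ℚ] ringClassField K ι (3 * m)) θ = θ)
    (z : (V.baseChange (ringClassField K ι (3 * m))).toAffine.Point) (D : (W.baseChange (ringClassField K ι m)).toAffine.Point)
    (hD : Affine.Point.map ((RingClassField.inclusion ι hle).restrictScalars ℚ) D = genusTransport W C₁ hC₁ CV hV hθ2 z)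
    (emb : ringClassField K ι m →+* AlgebraicClosure K) (emb₃ : ringClassField K ι (3 * m) →+* AlgebraicClosure K)
    (hemb : ∀ x, emb₃ (RingClassField.inclusion ι hle x) = emb x)
    {Θ : AlgebraicClosure ℚ} (hΘ : Θ ^ 2 = algebraMap ℚ (AlgebraicClosure ℚ) (-3))
    (hΘθ : (Literature.NumberTheory.EllipticCurves.absClosureEquiv ℚ K).symm (emb₃ θ) = Θ) :
    (RatClosure.pointsEquiv (K := K) W).symm
        (Affine.Point.map (W' := W) emb.toRatAlgHom (pointGalHom W (ringClassField K ι m) (res gt) D)) =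
      genusTransport W C₁ hC₁ CV hV hΘ ((RatClosure.pointsEquiv (K := K) V).symm
        (Affine.Point.map (W' := V) emb₃.toRatAlgHom (pointGalHom V (ringClassField K ι (3 * m)) gt z))) := by
  have h1 := map_inclusion_pointGalHom_res_eq W C₁ hC₁ CV hV hK ι hm hle hres hθ2 gt hgt z D hD
  -- push through `emb₃`
  have hθK : (emb₃ θ) ^ 2 = algebraMap ℚ (AlgebraicClosure K) (-3) := by
    rw [← map_pow, hθ2]; exact emb₃.toRatAlgHom.commutes (-3)
  have hcomp : emb₃.toRatAlgHom.comp ((RingClassField.inclusion ι hle).restrictScalars ℚ) = emb.toRatAlgHom :=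
    AlgHom.ext fun x => hemb x
  have h2 : Affine.Point.map (W' := W) emb.toRatAlgHom (pointGalHom W (ringClassField K ι m) (res gt) D) =
      genusTransport W C₁ hC₁ CV hV hθK
        (Affine.Point.map (W' := V) emb₃.toRatAlgHom (pointGalHom V (ringClassField K ι (3 * m)) gt z)) := by
    rw [← hcomp, ← Affine.Point.map_map, h1]
    exact genusTransport_map_of_eq W C₁ hC₁ CV hV hθ2 hθK emb₃.toRatAlgHom rfl _
  rw [h2, pointsEquiv_symm_apply, pointsEquiv_symm_apply]
  exact genusTransport_map_of_eq W C₁ hC₁ CV hV hθK hΘ (Literature.NumberTheory.EllipticCurves.absClosureEquiv ℚ K).symm.toAlgHom hΘθ _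


/-! ## §3 Label (B5) for the descended family -/

set_option maxHeartbeats 800000 in -- four ring class levels and two algebraic closures
/-- **Label (B5) for the descended family at level `m` above an inert good prime `ℓ ≠ 3` (`ℓ = 2` included).** Data: levels
`m/ℓ ≤ m ≤ 3m`, `m/ℓ ≤ 3(m/ℓ) ≤ 3m`, the restriction `res_m : Gal(K[3m]/K) → Aut(K[m])`, the genus involutions `σ_m` (level `3m`,
`σ_m θ = −θ`) and `σ′` (level `3(m/ℓ)`) with `σ_m(y′↑) = (σ′y′)↑`, roots `θ`, `θ′` with the same complex value, the CM points `y = y(3m)`,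
`y′ = y(3(m/ℓ))` of `V`, the descents `D↑ = ψ_θ((1 − σ_m)y)`, `D′↑ = ψ_{θ′}((1 − σ′)y′)`, an embedding `emb : K[m] → K̄` over `K`, the
fact's (B5′) at level `3m` for EVERY `K`-embedding `K[3m] → K̄` (reduction `geomReduction` along `placeOver ℓ`, `ℓ`-Frobenius `φ₀`),
`γ ∈ Gal(K[m]/K)`, and scalars `c_m = χ₋₃(ℓ)·c_{m/ℓ}`. CONCLUSION: `red(θ_ℚ̄⁻¹(emb_*(γ(c_m•D)))) = φ₀ • red(θ_ℚ̄⁻¹(emb_*(γ((c_{m/ℓ}•D′)↑))))` —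
VERBATIM the (B5) clause of `ShimuraWalk.LabelsAt` for `ys(m) = c_m • D_m` (with `j = (·).map emb`).
[cite: GrossLMS1991, §3 Prop. 3.7 (2)] [cite: Nekovar2007, (4.9), (4.13) (ii)] [cite: SilvermanAEC2009, VII.2 Prop. 2.1, X.5 Cor. 5.4 (iii)] -/
theorem labelB5_of_descents [W.IsElliptic] [W.IsGloballyMinimal] [V.IsElliptic] [V.IsGloballyMinimal]
    (hK : IsImaginaryQuadratic K) (ι : K →+* ℂ) {m ℓ : ℕ} (hm : m ≠ 0) [Fact ℓ.Prime] (hℓ3 : ℓ ≠ 3)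
    (hle : ringClassField K ι m ≤ ringClassField K ι (3 * m))
    (hle' : ringClassField K ι (m / ℓ) ≤ ringClassField K ι (3 * (m / ℓ)))
    (hle₃ : ringClassField K ι (3 * (m / ℓ)) ≤ ringClassField K ι (3 * m))
    (hdm : ringClassField K ι (m / ℓ) ≤ ringClassField K ι m)
    {resm : ringClassGal ι (3 * m) →* (ringClassField K ι m ≃ₐ[ℚ] ringClassField K ι m)}
    (hresm : ∀ (g : ringClassGal ι (3 * m)) (x : ringClassField K ι m) (y : ringClassField K ι (3 * m)),
      (x : ℂ) = (y : ℂ) → ((resm g x : ringClassField K ι m) : ℂ) =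
        (((g : ringClassField K ι (3 * m) ≃ₐ[ℚ] ringClassField K ι (3 * m)) y : ringClassField K ι (3 * m)) : ℂ))
    {σm : ringClassField K ι (3 * m) ≃ₐ[ℚ] ringClassField K ι (3 * m)} (hσm : σm ∈ ringClassGalOver ι (3 * m) m)
    {σ' : ringClassField K ι (3 * (m / ℓ)) ≃ₐ[ℚ] ringClassField K ι (3 * (m / ℓ))}
    {θ : ringClassField K ι (3 * m)} (hθ2 : θ ^ 2 = algebraMap ℚ (ringClassField K ι (3 * m)) (-3)) (hσmθ : σm θ = -θ)
    {θ' : ringClassField K ι (3 * (m / ℓ))} (hθ'2 : θ' ^ 2 = algebraMap ℚ (ringClassField K ι (3 * (m / ℓ))) (-3))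
    (hθθ' : (θ : ℂ) = (θ' : ℂ))
    (y : (V.baseChange (ringClassField K ι (3 * m))).toAffine.Point) (y' : (V.baseChange (ringClassField K ι (3 * (m / ℓ)))).toAffine.Point)
    (hσy' : pointGalHom V (ringClassField K ι (3 * m)) σm
        (Affine.Point.map (W' := V) ((RingClassField.inclusion ι hle₃).restrictScalars ℚ) y') =
      Affine.Point.map (W' := V) ((RingClassField.inclusion ι hle₃).restrictScalars ℚ)
        (pointGalHom V (ringClassField K ι (3 * (m / ℓ))) σ' y'))
    (D : (W.baseChange (ringClassField K ι m)).toAffine.Point)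
    (hD : Affine.Point.map ((RingClassField.inclusion ι hle).restrictScalars ℚ) D =
      genusTransport W C₁ hC₁ CV hV hθ2 (y - pointGalHom V (ringClassField K ι (3 * m)) σm y))
    (D' : (W.baseChange (ringClassField K ι (m / ℓ))).toAffine.Point)
    (hD' : Affine.Point.map ((RingClassField.inclusion ι hle').restrictScalars ℚ) D' =
      genusTransport W C₁ hC₁ CV hV hθ'2 (y' - pointGalHom V (ringClassField K ι (3 * (m / ℓ))) σ' y'))
    (hΔW : ¬ (ℓ : ℤ) ∣ minimalDiscriminantInt W) (hΔV : ¬ (ℓ : ℤ) ∣ minimalDiscriminantInt V)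
    {φ₀ : absoluteGaloisGroup (ZMod ℓ)} (hφ₀ : ∀ x : AlgebraicClosure (ZMod ℓ), φ₀ • x = x ^ ℓ)
    (emb : ringClassField K ι m →+* AlgebraicClosure K)
    (hembK : ∀ x : K, emb (algebraMap K (ringClassField K ι m) x) = algebraMap K (AlgebraicClosure K) x)
    (hB5V : ∀ (emb₃ : ringClassField K ι (3 * m) →+* AlgebraicClosure K),
      (∀ x : K, emb₃ (algebraMap K (ringClassField K ι (3 * m)) x) = algebraMap K (AlgebraicClosure K) x) →
      ∀ γ₃ : ringClassField K ι (3 * m) ≃ₐ[ℚ] ringClassField K ι (3 * m), γ₃ ∈ ringClassGal ι (3 * m) →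
        geomReduction hΔV ((RatClosure.pointsEquiv (K := K) V).symm
            (Affine.Point.map (W' := V) emb₃.toRatAlgHom (pointGalHom V (ringClassField K ι (3 * m)) γ₃ y))) =
          φ₀ • geomReduction hΔV ((RatClosure.pointsEquiv (K := K) V).symm
            (Affine.Point.map (W' := V) emb₃.toRatAlgHom (pointGalHom V (ringClassField K ι (3 * m)) γ₃
              (Affine.Point.map (W' := V) ((RingClassField.inclusion ι hle₃).restrictScalars ℚ) y')))))
    {γ : ringClassField K ι m ≃ₐ[ℚ] ringClassField K ι m} (hγ : γ ∈ ringClassGal ι m)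
    (cm cm' : ℤ) (hχ : cm = (if ℓ % 3 = 1 then 1 else -1) * cm') :
    geomReduction hΔW ((RatClosure.pointsEquiv (K := K) W).symm
        (Affine.Point.map (W' := W) emb.toRatAlgHom (pointGalHom W (ringClassField K ι m) γ (cm • D)))) =
      φ₀ • geomReduction hΔW ((RatClosure.pointsEquiv (K := K) W).symm
        (Affine.Point.map (W' := W) emb.toRatAlgHom (pointGalHom W (ringClassField K ι m) γ
          (Affine.Point.map (W' := W) ((RingClassField.inclusion ι hdm).restrictScalars ℚ) (cm' • D'))))) := by
  have hn : 3 * m ≠ 0 := mul_ne_zero three_ne_zero hm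
  have hσmG : σm ∈ ringClassGal ι (3 * m) := ringClassGalOver_le_ringClassGal ι _ _ hσm
  -- §1: extend the embedding; it stays a `K`-embedding
  obtain ⟨emb₃, hemb⟩ := exists_ringHom_extension hK ι hn hle emb
  have hemb₃K : ∀ x : K, emb₃ (algebraMap K (ringClassField K ι (3 * m)) x) = algebraMap K (AlgebraicClosure K) x := by
    intro x
    rw [← (RingClassField.inclusion ι hle).commutes x, hemb, hembK]
  -- lift `γ` to `γ̃` fixing `θ`
  obtain ⟨gt, hgt, hgtθ⟩ := exists_lift_apply_theta_eq hK ι hm hresm hσm hθ2 hσmθ hγ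
  subst hgt
  -- the root over `ℚ̄`
  obtain ⟨Θ, hΘθ⟩ : ∃ Θ : AlgebraicClosure ℚ, (Literature.NumberTheory.EllipticCurves.absClosureEquiv ℚ K).symm (emb₃ θ) = Θ :=
    ⟨_, rfl⟩
  have hΘ : Θ ^ 2 = algebraMap ℚ (AlgebraicClosure ℚ) (-3) := by
    rw [← hΘθ, ← map_pow, ← map_pow, hθ2]
    rw [show emb₃ (algebraMap ℚ (ringClassField K ι (3 * m)) (-3)) = algebraMap ℚ (AlgebraicClosure K) (-3) from
      emb₃.toRatAlgHom.commutes (-3)]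
    exact (Literature.NumberTheory.EllipticCurves.absClosureEquiv ℚ K).symm.toAlgHom.commutes (-3)
  -- the two composite reduction maps
  obtain ⟨FV, hFV⟩ : ∃ FV : (V.baseChange (ringClassField K ι (3 * m))).toAffine.Point →+ (reductionModPrime V ℓ).geomPoints,
      ∀ P, FV P = geomReduction hΔV ((RatClosure.pointsEquiv (K := K) V).symm (Affine.Point.map (W' := V) emb₃.toRatAlgHom P)) :=
    ⟨(geomReduction hΔV).comp ((RatClosure.pointsEquiv (K := K) V).symm.toAddMonoidHom.comp
      (Affine.Point.map (W' := V) emb₃.toRatAlgHom)), fun P => rfl⟩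
  obtain ⟨FW, hFW⟩ : ∃ FW : (W.baseChange (ringClassField K ι m)).toAffine.Point →+ (reductionModPrime W ℓ).geomPoints,
      ∀ P, FW P = geomReduction hΔW ((RatClosure.pointsEquiv (K := K) W).symm (Affine.Point.map (W' := W) emb.toRatAlgHom
        (pointGalHom W (ringClassField K ι m) (resm gt) P))) :=
    ⟨(geomReduction hΔW).comp ((RatClosure.pointsEquiv (K := K) W).symm.toAddMonoidHom.comp
      ((Affine.Point.map (W' := W) emb.toRatAlgHom).comp (pointGalHom W (ringClassField K ι m) (resm gt)))), fun P => rfl⟩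
  -- (B5′) at `γ̃` and at `γ̃σ_m`; the difference
  have hmul : ∀ P : (V.baseChange (ringClassField K ι (3 * m))).toAffine.Point,
      pointGalHom V (ringClassField K ι (3 * m)) (gt : _ ≃ₐ[ℚ] _) (pointGalHom V (ringClassField K ι (3 * m)) σm P) =
        pointGalHom V (ringClassField K ι (3 * m)) ((gt : _ ≃ₐ[ℚ] _) * σm) P := fun P => by rw [map_mul]; rfl
  have hB1 := hB5V emb₃ hemb₃K gt gt.2
  have hB2 := hB5V emb₃ hemb₃K ((gt : _ ≃ₐ[ℚ] _) * σm) (Subgroup.mul_mem _ gt.2 hσmG)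
  rw [← hFV, ← hFV] at hB1 hB2
  have hQ : FV (pointGalHom V (ringClassField K ι (3 * m)) (gt : _ ≃ₐ[ℚ] _)
        (y - pointGalHom V (ringClassField K ι (3 * m)) σm y)) =
      φ₀ • FV (pointGalHom V (ringClassField K ι (3 * m)) (gt : _ ≃ₐ[ℚ] _)
        (Affine.Point.map (W' := V) ((RingClassField.inclusion ι hle₃).restrictScalars ℚ)
          (y' - pointGalHom V (ringClassField K ι (3 * (m / ℓ))) σ' y'))) := by
    rw [map_sub (Affine.Point.map (W' := V) ((RingClassField.inclusion ι hle₃).restrictScalars ℚ)), ← hσy',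
      map_sub (pointGalHom V (ringClassField K ι (3 * m)) (gt : _ ≃ₐ[ℚ] _)),
      map_sub (pointGalHom V (ringClassField K ι (3 * m)) (gt : _ ≃ₐ[ℚ] _)), hmul, hmul, map_sub FV, map_sub FV,
      hB1, hB2, smul_sub]
  rw [hFV, hFV] at hQ
  -- the (B5) core through `ψ_Θ`
  have hcore := geomReduction_genusTransport_eq_of_eq W C₁ hC₁ CV hV hℓ3 hΔW hΔV hφ₀ hΘ hQ
  -- reading the two descents over `ℚ̄`
  have hL := pointsEquiv_symm_map_descent_eq W C₁ hC₁ CV hV hK ι hm hle hresm hθ2 gt hgtθ _ D hD emb emb₃ hemb hΘ hΘθ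
  have hD'' : Affine.Point.map ((RingClassField.inclusion ι hle).restrictScalars ℚ)
        (Affine.Point.map (W' := W) ((RingClassField.inclusion ι hdm).restrictScalars ℚ) D') =
      genusTransport W C₁ hC₁ CV hV hθ2 (Affine.Point.map (W' := V) ((RingClassField.inclusion ι hle₃).restrictScalars ℚ)
        (y' - pointGalHom V (ringClassField K ι (3 * (m / ℓ))) σ' y')) := by
    rw [RingClassField.map_inclusion_map_inclusion ι W hdm hle (hdm.trans hle),
      ← RingClassField.map_inclusion_map_inclusion ι W hle' hle₃ (hdm.trans hle), hD',
      genusTransport_map_inclusion W C₁ hC₁ CV hV ι hle₃ hθ2 hθ'2 hθθ']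
  have hR := pointsEquiv_symm_map_descent_eq W C₁ hC₁ CV hV hK ι hm hle hresm hθ2 gt hgtθ _ _ hD'' emb emb₃ hemb hΘ hΘθ
  -- assemble
  have hsq : ((if ℓ % 3 = 1 then 1 else -1 : ℤ)) * (if ℓ % 3 = 1 then 1 else -1 : ℤ) = 1 := by split_ifs <;> norm_num
  have hcm' : cm * (if ℓ % 3 = 1 then 1 else -1 : ℤ) = cm' := by rw [hχ, mul_comm, ← mul_assoc, hsq, one_mul]
  rw [← hFW, ← hFW, map_zsmul FW, map_zsmul (Affine.Point.map (W' := W) ((RingClassField.inclusion ι hdm).restrictScalars ℚ)),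
    map_zsmul FW, hFW, hFW, hL, hR, hcore, smul_smul, hcm']
  exact smul_comm cm' φ₀ _


end Read

end Summit.BirchSwinnertonDyer.BirchSwinnertonDyer.Theorems.LeafPartnerGenusLabelB5

end
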